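import Mathlib.LinearAlgebra.Matrix.NonsingularInverse
import Mathlib.Data.Matrix.ColumnRowPartitioned
import Mathlib.GroupTheory.Coset.Basic
import Literature.NumberTheory.Automorphic.UnitaryGroupDoubledSiegelBruhat
import Literature.NumberTheory.Automorphic.UnitaryGroupDirectSum
import HarnessLib

/-!
# The doubling orbit lemma: `P_Δ(K) \ U(𝕍 ⊕ −𝕍)(K) / i(U(𝕍)(K) × U(𝕍)(K))` is one point for `𝕍` anisotropic,
# with stabiliser the diagonal

Topic `NumberTheory/Automorphic`; namespace `Literature.NumberTheory.Automorphic.DoubledUnitary` (sequel of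
`UnitaryGroupDoubledSiegelGeneration` ∕ `UnitaryGroupDoubledSiegelBruhat`; the doubling embedding is the tree's
`UnitaryGroup.blockDiagGL (g₁, g₂) = diag(g₁, g₂)` of `UnitaryGroupDirectSum`).  KERNEL only: proved theorems, no
definition, no named fact, no `sorry`.

Setting ([GelbartPiatetskishapiroRallis1987, Part A §2 pp. 7–9]; [HarrisKudlaSweet1996, §1 (1.2)–(1.3)]): `K` a field with a
ring endomorphism `σ` (no involutivity is needed), `S ∈ M_ι(K)` the Gram matrix of a `σ`-hermitian space `𝕍` with pairing
`h(x, y) = σ(x)ᵀ S y` (the tree's `UnitaryGroup.hermForm σ S`), `G = U(σ, S) = unitaryGroupOfForm σ S`; the DOUBLED space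
`𝔻 = 𝕍 ⊕ (−𝕍)` with Gram matrix `diagForm S = S ⊕ (−S)`, `H = U(σ, S ⊕ −S)`, the doubling embedding
`i(g₁, g₂) = diag(g₁, g₂) : G × G → H` (`UnitaryGroup.blockDiagGL`), and the Siegel parabolic `P = P_Δ` = the stabiliser
of the diagonal `Δ = 𝕍^d = {(u, u)}`, i.e. the tree's block condition `IsSiegelSum p : p₁₁ + p₁₂ = p₂₁ + p₂₂`.

MAIN RESULTS — the `F`-points group theory behind the unfolding of the doubling ∕ Siegel–Weil Eisenstein series
`E(i(h₁, h₂)) = Σ_{γ ∈ P(F)\H(F)} f(γ i(h₁, h₂))` on the unique open orbit ([GelbartPiatetskishapiroRallis1987, Part A §2,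
Lemma 2.1 p. 8 and p. 9: «the stabilizer of `V^d` in `G × G` is `(G × G) ∩ P` … iff `g₁ = g₂`»]; [HarrisKudlaSweet1996, §1
(1.2)–(1.3)]; [Li1992, (24)–(25) p. 184]):
* §1 `P_Δ(K)` is a group: `IsSiegelSum.one ∕ mul ∕ inv` (no such closure lemma was in the tree), and the `Δ`-block
  `p₁₁ + p₁₂` of a Siegel element is invertible (`IsSiegelSum.isUnit_rowSum`);
* §2 **the stabiliser**: `isSiegelSum_blockDiagGL_iff : IsSiegelSum (i(γ₁, γ₂)) ↔ γ₁ = γ₂` — `(G × G) ∩ P = G^d`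
  (any rank, any `S`), and `i(γ₁, γ₂) ∈ H ↔ γ₁, γ₂ ∈ G` (`blockDiagGL_mem_diagForm_iff`);
* §3 **the orbit lemma for `𝕍` ANISOTROPIC** (`hS : ∀ v, h(v, v) = 0 → v = 0`; any rank): every `g ∈ H` is `i(γ, 1) · p`
  and `p′ · i(γ′, 1)` with `γ, γ′ ∈ G` UNIQUE and `p, p′ ∈ P_Δ` (`existsUnique_isSiegelSum_blockDiagGL_inv_mul`,
  `existsUnique_isSiegelSum_mul_blockDiagGL_inv`) — i.e. `H(K) = i(G × 1) · P = P · i(G × 1)`: in the language of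
  Lemma 2.1, `κ(L) = dim(L ∩ 𝕍⁺)` is the only `G × G`-orbit invariant of a Lagrangian `L` and `L ∩ 𝕍⁺` is totally
  isotropic, so for `𝕍` anisotropic `κ ≡ 0` and `X = P\H` is the single orbit `X₀ ∋ 𝕍^d`.  The proof is two-block linear
  algebra: the `Δ`-columns `x = g₁₁ + g₁₂`, `y = g₂₁ + g₂₂` of `g` satisfy `σ(x)ᵀ S x = σ(y)ᵀ S y` (`Δ` is isotropic and `g`
  is an isometry), anisotropy makes both invertible, and `γ := x y⁻¹ ∈ G` with `i(γ, 1)⁻¹ g ∈ P_Δ`;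
* §4 ABSTRACT PACKAGING (pure group theory, to be instantiated by consumers inside any group into which `H(K)` is mapped
  injectively, e.g. Weil's rational lift): for `P ≤ H`, `j : G →* H` with the orbit property `∀ h, ∃ γ, (j γ)⁻¹ h ∈ P` and
  the stabiliser property `∀ γ, j γ ∈ P → γ = 1`, the map `γ ↦ (j γ) P` is a BIJECTION `G ≃ H ⧸ P`
  (`bijective_quotientMk_of_orbit`); right-coset twin `γ ↦ P (j γ)`, `G ≃ P \ H` (`bijective_rightCosetMk_of_orbit`) —
  the index set of the Eisenstein sum;
* §5 RANK ONE (`[Unique ι]`, `det S` a unit): anisotropy is automatic (`anisotropic_of_isUnit_det`), whence the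
  hypothesis-free rank-one orbit lemma (`existsUnique_…_of_rank_one`) — the case `W` of dimension `1` of the Rallis inner
  product formula [Li1992, §2];
* §6 the same statements re-enumerated along `e : ι ⊕ ι ≃ m` (`IsSiegelReindex e`, `UnitaryGroup.reindexGL e`), and §7 their
  subgroup-typed form in the `J ⊕ᶠ (−J)` ∕ `UnitaryGroup.blockDiagFin` spelling of the tree's see-saw carriers
  (`e = finSumFinEquiv`; `finSum_neg_eq_reindex_diagForm : S ⊕ᶠ (−S) = reindex e₂ e₂ (diagForm S)` is `rfl`).

NOT here (downstream bookkeeping of the consumer): the identification of `P_Δ(F)` with the symplectic Siegel parabolic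
`P_Y(F) ∩ H(F)` under Li's `δ` and the transport into Weil's rational lift (`Weil1964/AdelicDoublingDiagonalLift`).

Written for the Hodge-CM cell `pub/hodgecm-mathlib`, floor 0, line `F0_P4AdmissibleOccursInH1` ∕ E-2 child
`F0_E2SiegelWeilWeilRange`, stub `stub_SW3_orbit` (F-points core; seat F0P4-p08, 2026-08-31).

## References

* [GelbartPiatetskishapiroRallis1987] S. Gelbart, I. Piatetski-Shapiro, S. Rallis, *Explicit Constructions of Automorphic
  L-Functions*, LNM 1254 (1987), Part A §2 pp. 7–9, Lemma 2.1 (orbits of `G × G` on `P\H` ↔ `κ(L)`; stabiliser of `V^d`).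
* [HarrisKudlaSweet1996] M. Harris, S. S. Kudla, W. J. Sweet, J. Amer. Math. Soc. 9 (1996) 941–1004, §1 (1.2)–(1.3).
* [Li1992] J.-S. Li, J. reine angew. Math. 428 (1992) 177–217, §2 (24)–(25) p. 184 (the unfolding at rank one).
-/

set_option autoImplicit false

noncomputable section

open scoped Matrix MatrixGroups
open Matrix

namespace Literature.NumberTheory.Automorphic

namespace DoubledUnitary

open UnitaryGroup (blockDiagGL coe_blockDiagGL hermForm hermForm_apply reindexGL coe_reindexGL)

variable {K : Type*} [Field K] {ι : Type*} [Fintype ι] [DecidableEq ι] (σ : K →+* K)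

/-! ## §1 `P_Δ(K)` is a group; the `Δ`-block of a Siegel element is invertible -/

section SiegelGroup

/-- **the `Δ`-row-sums of a product with a Siegel element**: if `p₁₁ + p₁₂ = p₂₁ + p₂₂ =: X` then
`(g p)₁₁ + (g p)₁₂ = (g₁₁ + g₁₂) X` and `(g p)₂₁ + (g p)₂₂ = (g₂₁ + g₂₂) X` (`g p (u, u) = g (X u, X u)`).
[cite: HarrisKudlaSweet1996, §1 (1.11)] -/
theorem rowSum_mul_of_isSiegelSum (g : GL (ι ⊕ ι) K) {p : GL (ι ⊕ ι) K} (hp : IsSiegelSum p) :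
    ((g * p : GL (ι ⊕ ι) K) : Matrix (ι ⊕ ι) (ι ⊕ ι) K).toBlocks₁₁ +
        ((g * p : GL (ι ⊕ ι) K) : Matrix (ι ⊕ ι) (ι ⊕ ι) K).toBlocks₁₂ =
      ((g : Matrix (ι ⊕ ι) (ι ⊕ ι) K).toBlocks₁₁ + (g : Matrix (ι ⊕ ι) (ι ⊕ ι) K).toBlocks₁₂) *
        ((p : Matrix (ι ⊕ ι) (ι ⊕ ι) K).toBlocks₁₁ + (p : Matrix (ι ⊕ ι) (ι ⊕ ι) K).toBlocks₁₂) ∧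
    ((g * p : GL (ι ⊕ ι) K) : Matrix (ι ⊕ ι) (ι ⊕ ι) K).toBlocks₂₁ +
        ((g * p : GL (ι ⊕ ι) K) : Matrix (ι ⊕ ι) (ι ⊕ ι) K).toBlocks₂₂ =
      ((g : Matrix (ι ⊕ ι) (ι ⊕ ι) K).toBlocks₂₁ + (g : Matrix (ι ⊕ ι) (ι ⊕ ι) K).toBlocks₂₂) *
        ((p : Matrix (ι ⊕ ι) (ι ⊕ ι) K).toBlocks₁₁ + (p : Matrix (ι ⊕ ι) (ι ⊕ ι) K).toBlocks₁₂) := by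
  have hp' : (p : Matrix (ι ⊕ ι) (ι ⊕ ι) K).toBlocks₂₁ + (p : Matrix (ι ⊕ ι) (ι ⊕ ι) K).toBlocks₂₂ =
      (p : Matrix (ι ⊕ ι) (ι ⊕ ι) K).toBlocks₁₁ + (p : Matrix (ι ⊕ ι) (ι ⊕ ι) K).toBlocks₁₂ := hp.symm
  have hmul : ((g * p : GL (ι ⊕ ι) K) : Matrix (ι ⊕ ι) (ι ⊕ ι) K) =
      Matrix.fromBlocks
        ((g : Matrix (ι ⊕ ι) (ι ⊕ ι) K).toBlocks₁₁ * (p : Matrix (ι ⊕ ι) (ι ⊕ ι) K).toBlocks₁₁ +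
          (g : Matrix (ι ⊕ ι) (ι ⊕ ι) K).toBlocks₁₂ * (p : Matrix (ι ⊕ ι) (ι ⊕ ι) K).toBlocks₂₁)
        ((g : Matrix (ι ⊕ ι) (ι ⊕ ι) K).toBlocks₁₁ * (p : Matrix (ι ⊕ ι) (ι ⊕ ι) K).toBlocks₁₂ +
          (g : Matrix (ι ⊕ ι) (ι ⊕ ι) K).toBlocks₁₂ * (p : Matrix (ι ⊕ ι) (ι ⊕ ι) K).toBlocks₂₂)
        ((g : Matrix (ι ⊕ ι) (ι ⊕ ι) K).toBlocks₂₁ * (p : Matrix (ι ⊕ ι) (ι ⊕ ι) K).toBlocks₁₁ +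
          (g : Matrix (ι ⊕ ι) (ι ⊕ ι) K).toBlocks₂₂ * (p : Matrix (ι ⊕ ι) (ι ⊕ ι) K).toBlocks₂₁)
        ((g : Matrix (ι ⊕ ι) (ι ⊕ ι) K).toBlocks₂₁ * (p : Matrix (ι ⊕ ι) (ι ⊕ ι) K).toBlocks₁₂ +
          (g : Matrix (ι ⊕ ι) (ι ⊕ ι) K).toBlocks₂₂ * (p : Matrix (ι ⊕ ι) (ι ⊕ ι) K).toBlocks₂₂) := by
    rw [Units.val_mul]
    conv_lhs => rw [← Matrix.fromBlocks_toBlocks (g : Matrix (ι ⊕ ι) (ι ⊕ ι) K),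
      ← Matrix.fromBlocks_toBlocks (p : Matrix (ι ⊕ ι) (ι ⊕ ι) K)]
    rw [Matrix.fromBlocks_multiply]
  rw [hmul]
  simp only [Matrix.toBlocks_fromBlocks₁₁, Matrix.toBlocks_fromBlocks₁₂, Matrix.toBlocks_fromBlocks₂₁,
    Matrix.toBlocks_fromBlocks₂₂]
  constructor
  · calc (g : Matrix (ι ⊕ ι) (ι ⊕ ι) K).toBlocks₁₁ * (p : Matrix (ι ⊕ ι) (ι ⊕ ι) K).toBlocks₁₁ +
            (g : Matrix (ι ⊕ ι) (ι ⊕ ι) K).toBlocks₁₂ * (p : Matrix (ι ⊕ ι) (ι ⊕ ι) K).toBlocks₂₁ +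
          ((g : Matrix (ι ⊕ ι) (ι ⊕ ι) K).toBlocks₁₁ * (p : Matrix (ι ⊕ ι) (ι ⊕ ι) K).toBlocks₁₂ +
            (g : Matrix (ι ⊕ ι) (ι ⊕ ι) K).toBlocks₁₂ * (p : Matrix (ι ⊕ ι) (ι ⊕ ι) K).toBlocks₂₂)
        = (g : Matrix (ι ⊕ ι) (ι ⊕ ι) K).toBlocks₁₁ *
            ((p : Matrix (ι ⊕ ι) (ι ⊕ ι) K).toBlocks₁₁ + (p : Matrix (ι ⊕ ι) (ι ⊕ ι) K).toBlocks₁₂) +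
          (g : Matrix (ι ⊕ ι) (ι ⊕ ι) K).toBlocks₁₂ *
            ((p : Matrix (ι ⊕ ι) (ι ⊕ ι) K).toBlocks₂₁ + (p : Matrix (ι ⊕ ι) (ι ⊕ ι) K).toBlocks₂₂) := by
          rw [Matrix.mul_add, Matrix.mul_add]; abel
      _ = _ := by rw [hp', Matrix.add_mul]
  · calc (g : Matrix (ι ⊕ ι) (ι ⊕ ι) K).toBlocks₂₁ * (p : Matrix (ι ⊕ ι) (ι ⊕ ι) K).toBlocks₁₁ +
            (g : Matrix (ι ⊕ ι) (ι ⊕ ι) K).toBlocks₂₂ * (p : Matrix (ι ⊕ ι) (ι ⊕ ι) K).toBlocks₂₁ +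
          ((g : Matrix (ι ⊕ ι) (ι ⊕ ι) K).toBlocks₂₁ * (p : Matrix (ι ⊕ ι) (ι ⊕ ι) K).toBlocks₁₂ +
            (g : Matrix (ι ⊕ ι) (ι ⊕ ι) K).toBlocks₂₂ * (p : Matrix (ι ⊕ ι) (ι ⊕ ι) K).toBlocks₂₂)
        = (g : Matrix (ι ⊕ ι) (ι ⊕ ι) K).toBlocks₂₁ *
            ((p : Matrix (ι ⊕ ι) (ι ⊕ ι) K).toBlocks₁₁ + (p : Matrix (ι ⊕ ι) (ι ⊕ ι) K).toBlocks₁₂) +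
          (g : Matrix (ι ⊕ ι) (ι ⊕ ι) K).toBlocks₂₂ *
            ((p : Matrix (ι ⊕ ι) (ι ⊕ ι) K).toBlocks₂₁ + (p : Matrix (ι ⊕ ι) (ι ⊕ ι) K).toBlocks₂₂) := by
          rw [Matrix.mul_add, Matrix.mul_add]; abel
      _ = _ := by rw [hp', Matrix.add_mul]

/-- `1 ∈ P_Δ(K)`. [cite: HarrisKudlaSweet1996, §1 (1.11)] -/
theorem IsSiegelSum.one : IsSiegelSum (1 : GL (ι ⊕ ι) K) := by
  unfold IsSiegelSum
  rw [Units.val_one, ← Matrix.fromBlocks_one]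
  simp only [Matrix.toBlocks_fromBlocks₁₁, Matrix.toBlocks_fromBlocks₁₂, Matrix.toBlocks_fromBlocks₂₁,
    Matrix.toBlocks_fromBlocks₂₂, add_zero, zero_add]

/-- **`P_Δ(K)` is closed under products** (it is the stabiliser of the diagonal `Δ`). [cite: HarrisKudlaSweet1996, §1 (1.11)] -/
theorem IsSiegelSum.mul {g p : GL (ι ⊕ ι) K} (hg : IsSiegelSum g) (hp : IsSiegelSum p) : IsSiegelSum (g * p) := by
  obtain ⟨h₁, h₂⟩ := rowSum_mul_of_isSiegelSum g hp
  unfold IsSiegelSum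
  rw [h₁, h₂]
  exact congrArg (· * _) hg

/-- **`P_Δ(K)` is closed under inverses.** [cite: HarrisKudlaSweet1996, §1 (1.11)] -/
theorem IsSiegelSum.inv {p : GL (ι ⊕ ι) K} (hp : IsSiegelSum p) : IsSiegelSum p⁻¹ := by
  obtain ⟨h₁, h₂⟩ := rowSum_mul_of_isSiegelSum p⁻¹ hp
  rw [inv_mul_cancel, Units.val_one, ← Matrix.fromBlocks_one] at h₁ h₂
  simp only [Matrix.toBlocks_fromBlocks₁₁, Matrix.toBlocks_fromBlocks₁₂, Matrix.toBlocks_fromBlocks₂₁,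
    Matrix.toBlocks_fromBlocks₂₂, add_zero, zero_add] at h₁ h₂
  -- `Y₁ X = 1 = Y₂ X` with `X` the `Δ`-block of `p` ⇒ `Y₁ = Y₂`
  set X := (p : Matrix (ι ⊕ ι) (ι ⊕ ι) K).toBlocks₁₁ + (p : Matrix (ι ⊕ ι) (ι ⊕ ι) K).toBlocks₁₂
  have hX : X * (((p⁻¹ : GL (ι ⊕ ι) K) : Matrix (ι ⊕ ι) (ι ⊕ ι) K).toBlocks₁₁ +
      ((p⁻¹ : GL (ι ⊕ ι) K) : Matrix (ι ⊕ ι) (ι ⊕ ι) K).toBlocks₁₂) = 1 := mul_eq_one_comm.1 h₁.symm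
  unfold IsSiegelSum
  calc ((p⁻¹ : GL (ι ⊕ ι) K) : Matrix (ι ⊕ ι) (ι ⊕ ι) K).toBlocks₁₁ +
          ((p⁻¹ : GL (ι ⊕ ι) K) : Matrix (ι ⊕ ι) (ι ⊕ ι) K).toBlocks₁₂
        = (((p⁻¹ : GL (ι ⊕ ι) K) : Matrix (ι ⊕ ι) (ι ⊕ ι) K).toBlocks₂₁ +
            ((p⁻¹ : GL (ι ⊕ ι) K) : Matrix (ι ⊕ ι) (ι ⊕ ι) K).toBlocks₂₂) *
          (X * (((p⁻¹ : GL (ι ⊕ ι) K) : Matrix (ι ⊕ ι) (ι ⊕ ι) K).toBlocks₁₁ +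
            ((p⁻¹ : GL (ι ⊕ ι) K) : Matrix (ι ⊕ ι) (ι ⊕ ι) K).toBlocks₁₂)) := by
          rw [← Matrix.mul_assoc, ← h₂, Matrix.one_mul]
    _ = _ := by rw [hX, Matrix.mul_one]

/-- the `Δ`-block `p₁₁ + p₁₂` of a Siegel element (its action on `Δ ≅ K^ι`) is invertible.
[cite: HarrisKudlaSweet1996, §1 (1.11)] -/
theorem IsSiegelSum.isUnit_rowSum {p : GL (ι ⊕ ι) K} (hp : IsSiegelSum p) :
    IsUnit ((p : Matrix (ι ⊕ ι) (ι ⊕ ι) K).toBlocks₁₁ + (p : Matrix (ι ⊕ ι) (ι ⊕ ι) K).toBlocks₁₂) := by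
  obtain ⟨h₁, -⟩ := rowSum_mul_of_isSiegelSum p⁻¹ hp
  rw [inv_mul_cancel, Units.val_one, ← Matrix.fromBlocks_one] at h₁
  simp only [Matrix.toBlocks_fromBlocks₁₁, Matrix.toBlocks_fromBlocks₁₂, add_zero] at h₁
  exact IsUnit.of_mul_eq_one_right _ h₁.symm

end SiegelGroup

/-! ## §2 The doubling embedding `i(γ₁, γ₂) = diag(γ₁, γ₂)` and `P_Δ`: the stabiliser is the diagonal -/

section Stabiliser

/-- **`(G × G) ∩ P_Δ = G^d`**: `diag(γ₁, γ₂)` stabilises the diagonal `Δ` iff `γ₁ = γ₂`.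
[cite: GelbartPiatetskishapiroRallis1987, Part A §2 p. 9] -/
theorem isSiegelSum_blockDiagGL_iff (γ₁ γ₂ : GL ι K) : IsSiegelSum (blockDiagGL (γ₁, γ₂)) ↔ γ₁ = γ₂ := by
  unfold IsSiegelSum
  rw [coe_blockDiagGL]
  simp only [Matrix.toBlocks_fromBlocks₁₁, Matrix.toBlocks_fromBlocks₁₂, Matrix.toBlocks_fromBlocks₂₁,
    Matrix.toBlocks_fromBlocks₂₂, add_zero, zero_add]
  exact Units.val_injective.eq_iff

/-- `diag(γ₁, γ₂) ∈ U(σ, S ⊕ −S) ↔ γ₁ ∈ U(σ, S) ∧ γ₂ ∈ U(σ, S)` (`U(σ, −S) = U(σ, S)`): the doubling embedding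
`i : G × G ↪ H`. [cite: GelbartPiatetskishapiroRallis1987, Part A §2 p. 7] -/
theorem blockDiagGL_mem_diagForm_iff (S : Matrix ι ι K) (γ₁ γ₂ : GL ι K) :
    blockDiagGL (γ₁, γ₂) ∈ unitaryGroupOfForm σ (diagForm S) ↔
      γ₁ ∈ unitaryGroupOfForm σ S ∧ γ₂ ∈ unitaryGroupOfForm σ S := by
  rw [mem_unitaryGroupOfForm_iff, mem_unitaryGroupOfForm_iff, mem_unitaryGroupOfForm_iff, coe_blockDiagGL, diagForm,
    Matrix.fromBlocks_map, Matrix.fromBlocks_transpose, Matrix.fromBlocks_multiply, Matrix.fromBlocks_multiply]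
  simp only [Matrix.map_zero σ (map_zero σ), Matrix.transpose_zero, Matrix.mul_zero, Matrix.zero_mul, add_zero,
    zero_add, Matrix.mul_neg, Matrix.neg_mul, Matrix.fromBlocks_inj, neg_inj, neg_zero, true_and]

/-- `diag(γ₁, γ₂) ∈ U(σ, S ⊕ −S)` for `γ₁, γ₂ ∈ U(σ, S)`. [cite: GelbartPiatetskishapiroRallis1987, Part A §2 p. 7] -/
theorem blockDiagGL_mem_diagForm {S : Matrix ι ι K} {γ₁ γ₂ : GL ι K} (h₁ : γ₁ ∈ unitaryGroupOfForm σ S)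
    (h₂ : γ₂ ∈ unitaryGroupOfForm σ S) : blockDiagGL (γ₁, γ₂) ∈ unitaryGroupOfForm σ (diagForm S) :=
  (blockDiagGL_mem_diagForm_iff σ S γ₁ γ₂).2 ⟨h₁, h₂⟩

/-- `i(γ, 1)⁻¹ = i(γ⁻¹, 1)` (`i` is a homomorphism on `G × 1`). [cite: GelbartPiatetskishapiroRallis1987, Part A §2 p. 7] -/
theorem blockDiagGL_inl_inv (γ : GL ι K) : (blockDiagGL (γ, (1 : GL ι K)))⁻¹ = blockDiagGL (γ⁻¹, 1) := by
  rw [← map_inv, Prod.inv_mk, inv_one]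

end Stabiliser

/-! ## §3 The orbit lemma for `𝕍` anisotropic: `H(K) = i(G × 1) · P_Δ(K) = P_Δ(K) · i(G × 1)`, uniquely -/

section Orbit

variable {σ}
variable {S : Matrix ι ι K}

omit [DecidableEq ι] in
/-- `h_S(g v, g w) = h_{σ(g)ᵀ S g}(v, w)` (the tree's `UnitaryGroup.hermForm_mulVec_of_isometry`, reproved to keep the
imports algebraic). [folklore] -/
private theorem hermForm_mulVec_mulVec (σ : K →+* K) (S g : Matrix ι ι K) (v w : ι → K) :
    hermForm σ S (g *ᵥ v) (g *ᵥ w) = hermForm σ ((g.map σ)ᵀ * S * g) v w := by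
  have h1 : (⇑σ ∘ (g *ᵥ v)) = g.map σ *ᵥ (⇑σ ∘ v) := funext fun i => RingHom.map_mulVec σ g v i
  rw [hermForm_apply, hermForm_apply, h1]
  calc (g.map σ *ᵥ (⇑σ ∘ v)) ⬝ᵥ (S *ᵥ (g *ᵥ w))
      = (((⇑σ ∘ v) ᵥ* (g.map σ)ᵀ) ᵥ* S ᵥ* g) ⬝ᵥ w := by
        rw [Matrix.vecMul_transpose, Matrix.dotProduct_mulVec, Matrix.dotProduct_mulVec]
    _ = ((⇑σ ∘ v) ᵥ* ((g.map σ)ᵀ * S * g)) ⬝ᵥ w := by rw [Matrix.vecMul_vecMul, Matrix.vecMul_vecMul, Matrix.mul_assoc]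
    _ = (⇑σ ∘ v) ⬝ᵥ (((g.map σ)ᵀ * S * g) *ᵥ w) := by rw [Matrix.dotProduct_mulVec]

omit [DecidableEq ι] in
/-- `h(0, 0) = 0`. [folklore] -/
private theorem hermForm_zero_zero (σ : K →+* K) (S : Matrix ι ι K) : hermForm σ S 0 0 = 0 := by
  rw [hermForm_apply, Matrix.mulVec_zero, dotProduct_zero]

/-- `g · (1 ; 1) = (g₁₁ + g₁₂ ; g₂₁ + g₂₂)`: the two `Δ`-columns of `g` (`g (u, u) = ((g₁₁ + g₁₂) u, (g₂₁ + g₂₂) u)`).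
[cite: GelbartPiatetskishapiroRallis1987, Part A §2 p. 8] -/
theorem mul_fromRows_one_one (g : GL (ι ⊕ ι) K) :
    (g : Matrix (ι ⊕ ι) (ι ⊕ ι) K) * Matrix.fromRows (1 : Matrix ι ι K) (1 : Matrix ι ι K) =
      Matrix.fromRows ((g : Matrix (ι ⊕ ι) (ι ⊕ ι) K).toBlocks₁₁ + (g : Matrix (ι ⊕ ι) (ι ⊕ ι) K).toBlocks₁₂)
        ((g : Matrix (ι ⊕ ι) (ι ⊕ ι) K).toBlocks₂₁ + (g : Matrix (ι ⊕ ι) (ι ⊕ ι) K).toBlocks₂₂) := by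
  conv_lhs => rw [← Matrix.fromBlocks_toBlocks (g : Matrix (ι ⊕ ι) (ι ⊕ ι) K)]
  rw [Matrix.fromBlocks_mul_fromRows, Matrix.mul_one, Matrix.mul_one, Matrix.mul_one, Matrix.mul_one]

/-- `g (w, w) = ((g₁₁ + g₁₂) w, (g₂₁ + g₂₂) w)`. [cite: GelbartPiatetskishapiroRallis1987, Part A §2 p. 8] -/
theorem mulVec_sumElim_self (g : GL (ι ⊕ ι) K) (w : ι → K) :
    (g : Matrix (ι ⊕ ι) (ι ⊕ ι) K) *ᵥ Sum.elim w w =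
      Sum.elim (((g : Matrix (ι ⊕ ι) (ι ⊕ ι) K).toBlocks₁₁ + (g : Matrix (ι ⊕ ι) (ι ⊕ ι) K).toBlocks₁₂) *ᵥ w)
        (((g : Matrix (ι ⊕ ι) (ι ⊕ ι) K).toBlocks₂₁ + (g : Matrix (ι ⊕ ι) (ι ⊕ ι) K).toBlocks₂₂) *ᵥ w) := by
  have h1 : Matrix.fromRows (1 : Matrix ι ι K) (1 : Matrix ι ι K) *ᵥ w = Sum.elim w w := by
    rw [Matrix.fromRows_mulVec, Matrix.one_mulVec]
  rw [← h1, Matrix.mulVec_mulVec, mul_fromRows_one_one, Matrix.fromRows_mulVec]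

/-- `σ(1 ; 1)ᵀ (S ⊕ −S) (1 ; 1) = S − S = 0`: the diagonal `Δ` is totally isotropic.
[cite: GelbartPiatetskishapiroRallis1987, Part A §2 p. 7] -/
theorem fromRows_one_one_isotropic (σ : K →+* K) (S : Matrix ι ι K) :
    ((Matrix.fromRows (1 : Matrix ι ι K) (1 : Matrix ι ι K)).map σ)ᵀ * diagForm S * Matrix.fromRows (1 : Matrix ι ι K) (1 : Matrix ι ι K) = 0 := by
  rw [Matrix.fromRows_map, Matrix.map_one σ (map_zero σ) (map_one σ), Matrix.transpose_fromRows, Matrix.transpose_one,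
    diagForm, Matrix.fromCols_mul_fromBlocks, Matrix.fromCols_mul_fromRows]
  simp

/-- **`Δ` is isotropic and `g` is an isometry**: the `Δ`-columns `x = g₁₁ + g₁₂`, `y = g₂₁ + g₂₂` of `g ∈ U(σ, S ⊕ −S)`
satisfy `σ(x)ᵀ S x = σ(y)ᵀ S y` (`g Δ` is a totally isotropic subspace of `𝕍 ⊕ (−𝕍)`).
[cite: GelbartPiatetskishapiroRallis1987, Part A §2 Lemma 2.1 p. 8] -/
theorem rowSum_isometry {g : GL (ι ⊕ ι) K} (hg : g ∈ unitaryGroupOfForm σ (diagForm S)) :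
    (((g : Matrix (ι ⊕ ι) (ι ⊕ ι) K).toBlocks₁₁ + (g : Matrix (ι ⊕ ι) (ι ⊕ ι) K).toBlocks₁₂).map σ)ᵀ * S *
        ((g : Matrix (ι ⊕ ι) (ι ⊕ ι) K).toBlocks₁₁ + (g : Matrix (ι ⊕ ι) (ι ⊕ ι) K).toBlocks₁₂) =
      (((g : Matrix (ι ⊕ ι) (ι ⊕ ι) K).toBlocks₂₁ + (g : Matrix (ι ⊕ ι) (ι ⊕ ι) K).toBlocks₂₂).map σ)ᵀ * S *
        ((g : Matrix (ι ⊕ ι) (ι ⊕ ι) K).toBlocks₂₁ + (g : Matrix (ι ⊕ ι) (ι ⊕ ι) K).toBlocks₂₂) := by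
  set x := (g : Matrix (ι ⊕ ι) (ι ⊕ ι) K).toBlocks₁₁ + (g : Matrix (ι ⊕ ι) (ι ⊕ ι) K).toBlocks₁₂ with hx
  set y := (g : Matrix (ι ⊕ ι) (ι ⊕ ι) K).toBlocks₂₁ + (g : Matrix (ι ⊕ ι) (ι ⊕ ι) K).toBlocks₂₂ with hy
  have hg' := mem_unitaryGroupOfForm_iff.1 hg
  have hE := mul_fromRows_one_one g
  have h1 : ((Matrix.fromRows x y).map σ)ᵀ * diagForm S * Matrix.fromRows x y =
      (x.map σ)ᵀ * S * x - (y.map σ)ᵀ * S * y := by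
    rw [Matrix.fromRows_map, Matrix.transpose_fromRows, diagForm, Matrix.fromCols_mul_fromBlocks,
      Matrix.fromCols_mul_fromRows]
    simp only [Matrix.mul_zero, add_zero, zero_add, Matrix.mul_neg, Matrix.neg_mul]
    rw [sub_eq_add_neg]
  have h2 : ((Matrix.fromRows x y).map σ)ᵀ * diagForm S * Matrix.fromRows x y = 0 := by
    rw [← hx, ← hy] at hE
    rw [← hE, Matrix.map_mul, Matrix.transpose_mul]
    calc ((Matrix.fromRows (1 : Matrix ι ι K) (1 : Matrix ι ι K)).map σ)ᵀ * ((g : Matrix (ι ⊕ ι) (ι ⊕ ι) K).map σ)ᵀ * diagForm S *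
            ((g : Matrix (ι ⊕ ι) (ι ⊕ ι) K) * Matrix.fromRows (1 : Matrix ι ι K) (1 : Matrix ι ι K))
          = ((Matrix.fromRows (1 : Matrix ι ι K) (1 : Matrix ι ι K)).map σ)ᵀ *
              ((((g : Matrix (ι ⊕ ι) (ι ⊕ ι) K).map σ)ᵀ * diagForm S * (g : Matrix (ι ⊕ ι) (ι ⊕ ι) K))) *
              Matrix.fromRows (1 : Matrix ι ι K) (1 : Matrix ι ι K) := by
            simp only [Matrix.mul_assoc]
      _ = 0 := by rw [hg', fromRows_one_one_isotropic]
  rw [h2] at h1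
  exact sub_eq_zero.1 h1.symm

/-- under ANISOTROPY of `𝕍`, the two `Δ`-columns of `g ∈ H` have the same kernel: `x w = 0 ↔ y w = 0`
(`h(x w, x w) = h(y w, y w)`). [cite: GelbartPiatetskishapiroRallis1987, Part A §2 Lemma 2.1 p. 8] -/
theorem rowSum_mulVec_eq_zero_iff (hS : ∀ v : ι → K, hermForm σ S v v = 0 → v = 0) {g : GL (ι ⊕ ι) K}
    (hg : g ∈ unitaryGroupOfForm σ (diagForm S)) (w : ι → K) :
    ((g : Matrix (ι ⊕ ι) (ι ⊕ ι) K).toBlocks₁₁ + (g : Matrix (ι ⊕ ι) (ι ⊕ ι) K).toBlocks₁₂) *ᵥ w = 0 ↔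
      ((g : Matrix (ι ⊕ ι) (ι ⊕ ι) K).toBlocks₂₁ + (g : Matrix (ι ⊕ ι) (ι ⊕ ι) K).toBlocks₂₂) *ᵥ w = 0 := by
  have key := rowSum_isometry hg
  constructor
  · intro h
    apply hS
    rw [hermForm_mulVec_mulVec, ← key, ← hermForm_mulVec_mulVec, h, hermForm_zero_zero]
  · intro h
    apply hS
    rw [hermForm_mulVec_mulVec, key, ← hermForm_mulVec_mulVec, h, hermForm_zero_zero]

/-- `x w = 0 = y w ⇒ w = 0` for the `Δ`-columns `x, y` of `g ∈ GL` (`g (w, w) = (x w, y w)` and `g` is invertible: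
the step «`L ∩ 𝕍⁺ = 0` forces the projection `L → 𝕍⁻` to be injective» of Lemma 2.1).
[cite: GelbartPiatetskishapiroRallis1987, Part A §2 Lemma 2.1 p. 8] -/
theorem eq_zero_of_rowSum_mulVec_eq_zero (g : GL (ι ⊕ ι) K) {w : ι → K}
    (hx : ((g : Matrix (ι ⊕ ι) (ι ⊕ ι) K).toBlocks₁₁ + (g : Matrix (ι ⊕ ι) (ι ⊕ ι) K).toBlocks₁₂) *ᵥ w = 0)
    (hy : ((g : Matrix (ι ⊕ ι) (ι ⊕ ι) K).toBlocks₂₁ + (g : Matrix (ι ⊕ ι) (ι ⊕ ι) K).toBlocks₂₂) *ᵥ w = 0) : w = 0 := by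
  have h := mulVec_sumElim_self g w
  rw [hx, hy] at h
  have h0 : (g : Matrix (ι ⊕ ι) (ι ⊕ ι) K) *ᵥ Sum.elim w w = (g : Matrix (ι ⊕ ι) (ι ⊕ ι) K) *ᵥ 0 := by
    rw [h, Matrix.mulVec_zero]
    funext i
    cases i <;> rfl
  have h1 := Matrix.mulVec_injective_iff_isUnit.2 (Units.isUnit g) h0
  funext i
  simpa using congrFun h1 (Sum.inl i)

/-- under anisotropy, the first `Δ`-column `g₁₁ + g₁₂` of `g ∈ H` is invertible.
[cite: GelbartPiatetskishapiroRallis1987, Part A §2 Lemma 2.1 p. 8] -/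
theorem isUnit_rowSum_inl (hS : ∀ v : ι → K, hermForm σ S v v = 0 → v = 0) {g : GL (ι ⊕ ι) K}
    (hg : g ∈ unitaryGroupOfForm σ (diagForm S)) :
    IsUnit ((g : Matrix (ι ⊕ ι) (ι ⊕ ι) K).toBlocks₁₁ + (g : Matrix (ι ⊕ ι) (ι ⊕ ι) K).toBlocks₁₂) := by
  rw [← Matrix.mulVec_injective_iff_isUnit]
  intro u u' huu'
  have hx : ((g : Matrix (ι ⊕ ι) (ι ⊕ ι) K).toBlocks₁₁ + (g : Matrix (ι ⊕ ι) (ι ⊕ ι) K).toBlocks₁₂) *ᵥ (u - u') = 0 := by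
    rw [Matrix.mulVec_sub]
    exact sub_eq_zero.2 huu'
  exact sub_eq_zero.1 (eq_zero_of_rowSum_mulVec_eq_zero g hx ((rowSum_mulVec_eq_zero_iff hS hg _).1 hx))

/-- under anisotropy, the second `Δ`-column `g₂₁ + g₂₂` of `g ∈ H` is invertible.
[cite: GelbartPiatetskishapiroRallis1987, Part A §2 Lemma 2.1 p. 8] -/
theorem isUnit_rowSum_inr (hS : ∀ v : ι → K, hermForm σ S v v = 0 → v = 0) {g : GL (ι ⊕ ι) K}
    (hg : g ∈ unitaryGroupOfForm σ (diagForm S)) :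
    IsUnit ((g : Matrix (ι ⊕ ι) (ι ⊕ ι) K).toBlocks₂₁ + (g : Matrix (ι ⊕ ι) (ι ⊕ ι) K).toBlocks₂₂) := by
  rw [← Matrix.mulVec_injective_iff_isUnit]
  intro u u' huu'
  have hy : ((g : Matrix (ι ⊕ ι) (ι ⊕ ι) K).toBlocks₂₁ + (g : Matrix (ι ⊕ ι) (ι ⊕ ι) K).toBlocks₂₂) *ᵥ (u - u') = 0 := by
    rw [Matrix.mulVec_sub]
    exact sub_eq_zero.2 huu'
  exact sub_eq_zero.1 (eq_zero_of_rowSum_mulVec_eq_zero g ((rowSum_mulVec_eq_zero_iff hS hg _).2 hy) hy)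

/-- `i(δ, 1) g ∈ P_Δ ↔ δ (g₁₁ + g₁₂) = g₂₁ + g₂₂`. [cite: GelbartPiatetskishapiroRallis1987, Part A §2 p. 9] -/
theorem isSiegelSum_blockDiagGL_mul_iff (δ : GL ι K) (g : GL (ι ⊕ ι) K) :
    IsSiegelSum (blockDiagGL (δ, (1 : GL ι K)) * g) ↔
      (δ : Matrix ι ι K) * ((g : Matrix (ι ⊕ ι) (ι ⊕ ι) K).toBlocks₁₁ + (g : Matrix (ι ⊕ ι) (ι ⊕ ι) K).toBlocks₁₂) =
        (g : Matrix (ι ⊕ ι) (ι ⊕ ι) K).toBlocks₂₁ + (g : Matrix (ι ⊕ ι) (ι ⊕ ι) K).toBlocks₂₂ := by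
  unfold IsSiegelSum
  have hmul : ((blockDiagGL (δ, (1 : GL ι K)) * g : GL (ι ⊕ ι) K) : Matrix (ι ⊕ ι) (ι ⊕ ι) K) =
      Matrix.fromBlocks ((δ : Matrix ι ι K) * (g : Matrix (ι ⊕ ι) (ι ⊕ ι) K).toBlocks₁₁)
        ((δ : Matrix ι ι K) * (g : Matrix (ι ⊕ ι) (ι ⊕ ι) K).toBlocks₁₂)
        ((g : Matrix (ι ⊕ ι) (ι ⊕ ι) K).toBlocks₂₁) ((g : Matrix (ι ⊕ ι) (ι ⊕ ι) K).toBlocks₂₂) := by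
    rw [Units.val_mul, coe_blockDiagGL]
    conv_lhs => rw [← Matrix.fromBlocks_toBlocks (g : Matrix (ι ⊕ ι) (ι ⊕ ι) K)]
    rw [Matrix.fromBlocks_multiply]
    simp only [Units.val_one, Matrix.one_mul, Matrix.zero_mul, add_zero, zero_add]
  rw [hmul]
  simp only [Matrix.toBlocks_fromBlocks₁₁, Matrix.toBlocks_fromBlocks₁₂, Matrix.toBlocks_fromBlocks₂₁,
    Matrix.toBlocks_fromBlocks₂₂, Matrix.mul_add]

/-- **THE ORBIT LEMMA (`H = i(G × 1) · P_Δ`).**  For `𝕍` anisotropic, every `g ∈ U(σ, S ⊕ −S)(K)` is `i(γ, 1) · p` with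
`γ ∈ U(σ, S)(K)` and `p ∈ P_Δ(K)`: `γ = (g₁₁ + g₁₂)(g₂₁ + g₂₂)⁻¹` (`P_Δ(K)\H(K)` is a single `i(G × G)(K)`-orbit —
Lemma 2.1 with `κ ≡ 0`). [cite: GelbartPiatetskishapiroRallis1987, Part A §2 Lemma 2.1 p. 8] -/
theorem exists_isSiegelSum_blockDiagGL_inv_mul (hS : ∀ v : ι → K, hermForm σ S v v = 0 → v = 0) {g : GL (ι ⊕ ι) K}
    (hg : g ∈ unitaryGroupOfForm σ (diagForm S)) :
    ∃ γ ∈ unitaryGroupOfForm σ S, IsSiegelSum ((blockDiagGL (γ, (1 : GL ι K)))⁻¹ * g) := by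
  have hx := isUnit_rowSum_inl hS hg
  have hy := isUnit_rowSum_inr hS hg
  have key := rowSum_isometry hg
  set x := (g : Matrix (ι ⊕ ι) (ι ⊕ ι) K).toBlocks₁₁ + (g : Matrix (ι ⊕ ι) (ι ⊕ ι) K).toBlocks₁₂ with hxdef
  set y := (g : Matrix (ι ⊕ ι) (ι ⊕ ι) K).toBlocks₂₁ + (g : Matrix (ι ⊕ ι) (ι ⊕ ι) K).toBlocks₂₂ with hydef
  have hX : ((hx.unit : GL ι K) : Matrix ι ι K) = x := hx.unit_spec
  have hY : ((hy.unit : GL ι K) : Matrix ι ι K) = y := hy.unit_spec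
  refine ⟨hx.unit * hy.unit⁻¹, ?_, ?_⟩
  · rw [mem_unitaryGroupOfForm_iff, Units.val_mul, Matrix.map_mul, Matrix.transpose_mul]
    calc (((hy.unit⁻¹ : GL ι K) : Matrix ι ι K).map σ)ᵀ * (((hx.unit : GL ι K) : Matrix ι ι K).map σ)ᵀ * S *
            (((hx.unit : GL ι K) : Matrix ι ι K) * ((hy.unit⁻¹ : GL ι K) : Matrix ι ι K))
          = (((hy.unit⁻¹ : GL ι K) : Matrix ι ι K).map σ)ᵀ *
              ((((hx.unit : GL ι K) : Matrix ι ι K).map σ)ᵀ * S * ((hx.unit : GL ι K) : Matrix ι ι K)) *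
              ((hy.unit⁻¹ : GL ι K) : Matrix ι ι K) := by
            simp only [Matrix.mul_assoc]
      _ = (((hy.unit⁻¹ : GL ι K) : Matrix ι ι K).map σ)ᵀ *
              ((((hy.unit : GL ι K) : Matrix ι ι K).map σ)ᵀ * S * ((hy.unit : GL ι K) : Matrix ι ι K)) *
              ((hy.unit⁻¹ : GL ι K) : Matrix ι ι K) := by
            rw [hX, key, hY]
      _ = ((((hy.unit : GL ι K) : Matrix ι ι K) * ((hy.unit⁻¹ : GL ι K) : Matrix ι ι K)).map σ)ᵀ * S *
              (((hy.unit : GL ι K) : Matrix ι ι K) * ((hy.unit⁻¹ : GL ι K) : Matrix ι ι K)) := by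
            rw [Matrix.map_mul, Matrix.transpose_mul]
            simp only [Matrix.mul_assoc]
      _ = S := by
            rw [← Units.val_mul, mul_inv_cancel, Units.val_one, Matrix.map_one σ (map_zero σ) (map_one σ),
              Matrix.transpose_one, Matrix.one_mul, Matrix.mul_one]
  · rw [blockDiagGL_inl_inv, _root_.mul_inv_rev, inv_inv, isSiegelSum_blockDiagGL_mul_iff, Units.val_mul, Matrix.mul_assoc]
    show ((hy.unit : GL ι K) : Matrix ι ι K) * (((hx.unit⁻¹ : GL ι K) : Matrix ι ι K) * x) = y
    rw [hx.val_inv_mul, Matrix.mul_one, hY]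

/-- uniqueness in the orbit lemma: `i(γ₁, 1)⁻¹ g, i(γ₂, 1)⁻¹ g ∈ P_Δ ⇒ γ₁ = γ₂` (the stabiliser is the diagonal).
[cite: GelbartPiatetskishapiroRallis1987, Part A §2 p. 9] -/
theorem eq_of_isSiegelSum_blockDiagGL_inv_mul {γ₁ γ₂ : GL ι K} {g : GL (ι ⊕ ι) K}
    (h₁ : IsSiegelSum ((blockDiagGL (γ₁, (1 : GL ι K)))⁻¹ * g)) (h₂ : IsSiegelSum ((blockDiagGL (γ₂, (1 : GL ι K)))⁻¹ * g)) :
    γ₁ = γ₂ := by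
  have h := h₁.mul h₂.inv
  have hprod : (blockDiagGL (γ₁, (1 : GL ι K)))⁻¹ * g * ((blockDiagGL (γ₂, (1 : GL ι K)))⁻¹ * g)⁻¹ =
      blockDiagGL (γ₁⁻¹ * γ₂, (1 : GL ι K)) := by
    rw [_root_.mul_inv_rev, inv_inv, mul_assoc, mul_inv_cancel_left, ← map_inv, ← map_mul, Prod.inv_mk, inv_one,
      Prod.mk_mul_mk, one_mul]
  rw [hprod, isSiegelSum_blockDiagGL_iff] at h
  exact inv_mul_eq_one.1 h

/-- **THE ORBIT LEMMA, unique form**: for `𝕍` anisotropic and `g ∈ U(σ, S ⊕ −S)(K)` there is a UNIQUE `γ ∈ U(σ, S)(K)` with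
`i(γ, 1)⁻¹ g ∈ P_Δ(K)` — the map `γ ↦ i(γ, 1) P_Δ(K)`, `U(σ, S)(K) → H(K) ∕ P_Δ(K)`, is a bijection.
[cite: GelbartPiatetskishapiroRallis1987, Part A §2 Lemma 2.1 p. 8; HarrisKudlaSweet1996, §1 (1.2)–(1.3)] -/
theorem existsUnique_isSiegelSum_blockDiagGL_inv_mul (hS : ∀ v : ι → K, hermForm σ S v v = 0 → v = 0) {g : GL (ι ⊕ ι) K}
    (hg : g ∈ unitaryGroupOfForm σ (diagForm S)) :
    ∃! γ : GL ι K, γ ∈ unitaryGroupOfForm σ S ∧ IsSiegelSum ((blockDiagGL (γ, (1 : GL ι K)))⁻¹ * g) := by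
  obtain ⟨γ, hγ, hγg⟩ := exists_isSiegelSum_blockDiagGL_inv_mul hS hg
  exact ⟨γ, ⟨hγ, hγg⟩, fun γ' hγ' => eq_of_isSiegelSum_blockDiagGL_inv_mul hγ'.2 hγg⟩

/-- **THE ORBIT LEMMA, mirror form (`H = P_Δ · i(G × 1)`).**  For `𝕍` anisotropic, every `g ∈ U(σ, S ⊕ −S)(K)` is
`p · i(γ, 1)` with `γ ∈ U(σ, S)(K)`, `p ∈ P_Δ(K)` (apply the orbit lemma to `g⁻¹`; right cosets `P_Δ(K) g` are the index set
of the Siegel Eisenstein series `Σ_{P(F)\H(F)}`). [cite: GelbartPiatetskishapiroRallis1987, Part A §2 Lemma 2.1 p. 8] -/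
theorem exists_isSiegelSum_mul_blockDiagGL_inv (hS : ∀ v : ι → K, hermForm σ S v v = 0 → v = 0) {g : GL (ι ⊕ ι) K}
    (hg : g ∈ unitaryGroupOfForm σ (diagForm S)) :
    ∃ γ ∈ unitaryGroupOfForm σ S, IsSiegelSum (g * (blockDiagGL (γ, (1 : GL ι K)))⁻¹) := by
  obtain ⟨γ, hγ, hγg⟩ := exists_isSiegelSum_blockDiagGL_inv_mul hS ((unitaryGroupOfForm σ (diagForm S)).inv_mem hg)
  refine ⟨γ⁻¹, (unitaryGroupOfForm σ S).inv_mem hγ, ?_⟩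
  have h := hγg.inv
  rw [_root_.mul_inv_rev, inv_inv, inv_inv] at h
  rwa [blockDiagGL_inl_inv, inv_inv]

/-- uniqueness in the mirror form: `g i(γ₁, 1)⁻¹, g i(γ₂, 1)⁻¹ ∈ P_Δ ⇒ γ₁ = γ₂`.
[cite: GelbartPiatetskishapiroRallis1987, Part A §2 p. 9] -/
theorem eq_of_isSiegelSum_mul_blockDiagGL_inv {γ₁ γ₂ : GL ι K} {g : GL (ι ⊕ ι) K}
    (h₁ : IsSiegelSum (g * (blockDiagGL (γ₁, (1 : GL ι K)))⁻¹)) (h₂ : IsSiegelSum (g * (blockDiagGL (γ₂, (1 : GL ι K)))⁻¹)) :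
    γ₁ = γ₂ := by
  have h := h₁.inv.mul h₂
  have hprod : (g * (blockDiagGL (γ₁, (1 : GL ι K)))⁻¹)⁻¹ * (g * (blockDiagGL (γ₂, (1 : GL ι K)))⁻¹) =
      blockDiagGL (γ₁ * γ₂⁻¹, (1 : GL ι K)) := by
    rw [_root_.mul_inv_rev, inv_inv, mul_assoc, inv_mul_cancel_left, ← map_inv, ← map_mul, Prod.inv_mk, inv_one,
      Prod.mk_mul_mk, one_mul]
  rw [hprod, isSiegelSum_blockDiagGL_iff] at h
  exact mul_inv_eq_one.1 h

/-- **THE ORBIT LEMMA, mirror unique form**: for `𝕍` anisotropic and `g ∈ U(σ, S ⊕ −S)(K)` there is a UNIQUE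
`γ ∈ U(σ, S)(K)` with `g i(γ, 1)⁻¹ ∈ P_Δ(K)` — `γ ↦ P_Δ(K) i(γ, 1)` is a bijection `U(σ, S)(K) → P_Δ(K) \ H(K)`.
[cite: GelbartPiatetskishapiroRallis1987, Part A §2 Lemma 2.1 p. 8; HarrisKudlaSweet1996, §1 (1.2)–(1.3)] -/
theorem existsUnique_isSiegelSum_mul_blockDiagGL_inv (hS : ∀ v : ι → K, hermForm σ S v v = 0 → v = 0) {g : GL (ι ⊕ ι) K}
    (hg : g ∈ unitaryGroupOfForm σ (diagForm S)) :
    ∃! γ : GL ι K, γ ∈ unitaryGroupOfForm σ S ∧ IsSiegelSum (g * (blockDiagGL (γ, (1 : GL ι K)))⁻¹) := by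
  obtain ⟨γ, hγ, hγg⟩ := exists_isSiegelSum_mul_blockDiagGL_inv hS hg
  exact ⟨γ, ⟨hγ, hγg⟩, fun γ' hγ' => eq_of_isSiegelSum_mul_blockDiagGL_inv hγ'.2 hγg⟩

end Orbit

/-! ## §4 Abstract packaging: one orbit with diagonal stabiliser ⇒ `G ≃ H ⧸ P` and `G ≃ P \ H` -/

section Abstract

variable {G H : Type*} [Group G] [Group H]

/-- **one orbit + trivial stabiliser ⇒ `γ ↦ (j γ) P` is a bijection `G → H ⧸ P`** (pure group theory; for the doubled
unitary group `j = i(·, 1)`, `P = P_Δ(F)`, the hypotheses are `exists_isSiegelSum_blockDiagGL_inv_mul` and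
`isSiegelSum_blockDiagGL_iff`, transported along any injective homomorphism of `H(F)`, e.g. into Weil's rational lift).
[cite: GelbartPiatetskishapiroRallis1987, Part A §2 Lemma 2.1 p. 8] -/
theorem bijective_quotientMk_of_orbit (P : Subgroup H) (j : G →* H) (horb : ∀ h : H, ∃ γ : G, (j γ)⁻¹ * h ∈ P)
    (hstab : ∀ γ : G, j γ ∈ P → γ = 1) :
    Function.Bijective (fun γ : G => (QuotientGroup.mk (j γ) : H ⧸ P)) := by
  refine ⟨fun γ₁ γ₂ h => ?_, fun q => ?_⟩
  · have h' : (j γ₁)⁻¹ * j γ₂ ∈ P := QuotientGroup.eq.1 h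
    rw [← map_inv, ← map_mul] at h'
    exact inv_mul_eq_one.1 (hstab _ h')
  · obtain ⟨h, rfl⟩ := QuotientGroup.mk_surjective q
    obtain ⟨γ, hγ⟩ := horb h
    exact ⟨γ, QuotientGroup.eq.2 hγ⟩

/-- **right-coset twin: `γ ↦ P (j γ)` is a bijection `G → P \ H`** (`Quotient (QuotientGroup.rightRel P)` — the index set
`P(F)\H(F)` of a Siegel Eisenstein series `Σ_{γ ∈ P(F)\H(F)} f(γ g)`), from the mirror orbit property `h (j γ)⁻¹ ∈ P`
(`exists_isSiegelSum_mul_blockDiagGL_inv`) and the trivial stabiliser. [cite: GelbartPiatetskishapiroRallis1987, Part A §2 Lemma 2.1 p. 8] -/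
theorem bijective_rightCosetMk_of_orbit (P : Subgroup H) (j : G →* H) (horb : ∀ h : H, ∃ γ : G, h * (j γ)⁻¹ ∈ P)
    (hstab : ∀ γ : G, j γ ∈ P → γ = 1) :
    Function.Bijective (fun γ : G => Quotient.mk (QuotientGroup.rightRel P) (j γ)) := by
  refine ⟨fun γ₁ γ₂ h => ?_, fun q => ?_⟩
  · have h' : j γ₂ * (j γ₁)⁻¹ ∈ P := QuotientGroup.rightRel_apply.1 (Quotient.exact h)
    rw [← map_inv, ← map_mul] at h'
    exact (mul_inv_eq_one.1 (hstab _ h')).symm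
  · obtain ⟨h, rfl⟩ := Quotient.mk_surjective q
    obtain ⟨γ, hγ⟩ := horb h
    exact ⟨γ, Quotient.sound (QuotientGroup.rightRel_apply.2 hγ)⟩

/-- unfolding a sum over `H ⧸ P` onto `G` along the bijection `γ ↦ (j γ) P` (`Function.Bijective.tsum_comp`-ready form:
`∑' q : H ⧸ P, f q = ∑' γ : G, f ((j γ) P)`). [cite: GelbartPiatetskishapiroRallis1987, Part A §2 Lemma 2.1 p. 8] -/
theorem tsum_quotient_eq_tsum_of_orbit {M : Type*} [AddCommMonoid M] [TopologicalSpace M] (P : Subgroup H) (j : G →* H)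
    (horb : ∀ h : H, ∃ γ : G, (j γ)⁻¹ * h ∈ P) (hstab : ∀ γ : G, j γ ∈ P → γ = 1) (f : H ⧸ P → M) :
    ∑' q : H ⧸ P, f q = ∑' γ : G, f (QuotientGroup.mk (j γ)) :=
  ((Equiv.ofBijective _ (bijective_quotientMk_of_orbit P j horb hstab)).tsum_eq f).symm

/-- right-coset twin of `tsum_quotient_eq_tsum_of_orbit`: `∑' q : P \ H, f q = ∑' γ : G, f (P (j γ))`.
[cite: GelbartPiatetskishapiroRallis1987, Part A §2 Lemma 2.1 p. 8] -/
theorem tsum_rightCoset_eq_tsum_of_orbit {M : Type*} [AddCommMonoid M] [TopologicalSpace M] (P : Subgroup H) (j : G →* H)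
    (horb : ∀ h : H, ∃ γ : G, h * (j γ)⁻¹ ∈ P) (hstab : ∀ γ : G, j γ ∈ P → γ = 1)
    (f : Quotient (QuotientGroup.rightRel P) → M) :
    ∑' q : Quotient (QuotientGroup.rightRel P), f q = ∑' γ : G, f (Quotient.mk (QuotientGroup.rightRel P) (j γ)) :=
  ((Equiv.ofBijective _ (bijective_rightCosetMk_of_orbit P j horb hstab)).tsum_eq f).symm

end Abstract

/-! ## §5 Rank one: a non-degenerate hermitian LINE is anisotropic, so the orbit lemma is hypothesis-free -/

section RankOne

variable [Unique ι]

/-- **in rank one a non-degenerate hermitian line is anisotropic**: `h(v, v) = σ(v) s v = 0` with `s = det S ≠ 0` forces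
`v = 0` (`σ` is injective, `K` a field). [cite: Li1992, §2 p. 182] -/
theorem anisotropic_of_isUnit_det {S : Matrix ι ι K} (hSu : IsUnit S.det) (v : ι → K) (hv : hermForm σ S v v = 0) :
    v = 0 := by
  have hs : S default default ≠ 0 := by rw [← Matrix.det_unique S]; exact hSu.ne_zero
  simp only [hermForm_apply, dotProduct, Matrix.mulVec, Fintype.sum_unique, Function.comp_apply] at hv
  have hvd : v default = 0 := by
    rcases mul_eq_zero.1 hv with h | h
    · exact (map_eq_zero_iff σ σ.injective).1 h
    · rcases mul_eq_zero.1 h with h' | h'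
      · exact absurd h' hs
      · exact h'
  funext i
  rw [Unique.eq_default i, hvd, Pi.zero_apply]

variable {σ}

/-- **THE RANK-ONE ORBIT LEMMA** (`W` a non-degenerate `σ`-hermitian line, `H = U(W ⊕ W⁻) ≅ U(1,1)`): every
`g ∈ U(σ, S ⊕ −S)(K)` is `i(γ, 1) · p`, `p ∈ P_Δ(K)`, for a UNIQUE `γ ∈ U(σ, S)(K)` — `U(W)(K) ≃ H(K) ∕ P_Δ(K)`,
`γ ↦ i(γ, 1) P_Δ(K)`; no anisotropy hypothesis. [cite: GelbartPiatetskishapiroRallis1987, Part A §2 Lemma 2.1 p. 8; Li1992, §2 (24)–(25) p. 184] -/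
theorem existsUnique_isSiegelSum_blockDiagGL_inv_mul_of_rank_one {S : Matrix ι ι K} (hSu : IsUnit S.det)
    {g : GL (ι ⊕ ι) K} (hg : g ∈ unitaryGroupOfForm σ (diagForm S)) :
    ∃! γ : GL ι K, γ ∈ unitaryGroupOfForm σ S ∧ IsSiegelSum ((blockDiagGL (γ, (1 : GL ι K)))⁻¹ * g) :=
  existsUnique_isSiegelSum_blockDiagGL_inv_mul (anisotropic_of_isUnit_det σ hSu) hg

/-- **THE RANK-ONE ORBIT LEMMA, mirror form**: every `g ∈ U(σ, S ⊕ −S)(K)` is `p · i(γ, 1)`, `p ∈ P_Δ(K)`, for a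
UNIQUE `γ ∈ U(σ, S)(K)` — `U(W)(K) ≃ P_Δ(K) \ H(K)`, `γ ↦ P_Δ(K) i(γ, 1)` (the index set of the doubling Eisenstein
series at rank one). [cite: GelbartPiatetskishapiroRallis1987, Part A §2 Lemma 2.1 p. 8; Li1992, §2 (24)–(25) p. 184] -/
theorem existsUnique_isSiegelSum_mul_blockDiagGL_inv_of_rank_one {S : Matrix ι ι K} (hSu : IsUnit S.det)
    {g : GL (ι ⊕ ι) K} (hg : g ∈ unitaryGroupOfForm σ (diagForm S)) :
    ∃! γ : GL ι K, γ ∈ unitaryGroupOfForm σ S ∧ IsSiegelSum (g * (blockDiagGL (γ, (1 : GL ι K)))⁻¹) :=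
  existsUnique_isSiegelSum_mul_blockDiagGL_inv (anisotropic_of_isUnit_det σ hSu) hg

end RankOne

/-! ## §6 Re-enumerated forms along `e : ι ⊕ ι ≃ m` (`J = reindex e e (S ⊕ −S)`, e.g. `e = finSumFinEquiv`: `J ⊕ᶠ (−J)`) -/

section Reindex

variable {σ}
variable {S : Matrix ι ι K} {m : Type*} [Fintype m] [DecidableEq m] (e : ι ⊕ ι ≃ m)

/-- `reindexGL e g ∈ P_Δ` (read through `e`) iff `g ∈ P_Δ`. [cite: HarrisKudlaSweet1996, §1 (1.11)] -/
theorem isSiegelReindex_reindexGL_iff (g : GL (ι ⊕ ι) K) : IsSiegelReindex e (reindexGL e g : GL m K) ↔ IsSiegelSum g :=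
  isSiegelReindex_mapEquiv_iff e g

/-- re-enumerated stabiliser: `reindex (diag(γ₁, γ₂)) ∈ P_Δ ↔ γ₁ = γ₂`. [cite: GelbartPiatetskishapiroRallis1987, Part A §2 p. 9] -/
theorem isSiegelReindex_reindexGL_blockDiagGL_iff (γ₁ γ₂ : GL ι K) :
    IsSiegelReindex e (reindexGL e (blockDiagGL (γ₁, γ₂)) : GL m K) ↔ γ₁ = γ₂ := by
  rw [isSiegelReindex_reindexGL_iff, isSiegelSum_blockDiagGL_iff]

/-- re-enumerated doubling embedding: `reindex (diag(γ₁, γ₂)) ∈ U(σ, reindex (S ⊕ −S)) ↔ γ₁, γ₂ ∈ U(σ, S)`.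
[cite: GelbartPiatetskishapiroRallis1987, Part A §2 p. 7] -/
theorem reindexGL_blockDiagGL_mem_iff (γ₁ γ₂ : GL ι K) :
    (reindexGL e (blockDiagGL (γ₁, γ₂)) : GL m K) ∈ unitaryGroupOfForm σ (Matrix.reindex e e (diagForm S)) ↔
      γ₁ ∈ unitaryGroupOfForm σ S ∧ γ₂ ∈ unitaryGroupOfForm σ S := by
  rw [UnitaryGroup.reindexGL_mem_iff, blockDiagGL_mem_diagForm_iff]

/-- **the orbit lemma, re-enumerated** (`𝕍` anisotropic): every `h ∈ U(σ, reindex e e (S ⊕ −S))(K)` is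
`reindex(i(γ, 1)) · p` with `p ∈ P_Δ(K)` for a unique `γ ∈ U(σ, S)(K)`.
[cite: GelbartPiatetskishapiroRallis1987, Part A §2 Lemma 2.1 p. 8] -/
theorem existsUnique_isSiegelReindex_inv_mul (hS : ∀ v : ι → K, hermForm σ S v v = 0 → v = 0) {h : GL m K}
    (hh : h ∈ unitaryGroupOfForm σ (Matrix.reindex e e (diagForm S))) :
    ∃! γ : GL ι K, γ ∈ unitaryGroupOfForm σ S ∧
      IsSiegelReindex e ((reindexGL e (blockDiagGL (γ, (1 : GL ι K))) : GL m K)⁻¹ * h) := by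
  set ψ : GL (ι ⊕ ι) K ≃* GL m K := Units.mapEquiv (Matrix.reindexRingEquiv K e).toMulEquiv with hψ
  have hψe : ∀ g : GL (ι ⊕ ι) K, (reindexGL e g : GL m K) = ψ g := fun g => rfl
  set g := ψ.symm h with hgdef
  have hψg : (reindexGL e g : GL m K) = h := by rw [hψe]; exact ψ.apply_symm_apply h
  have hg : g ∈ unitaryGroupOfForm σ (diagForm S) := by
    rw [← UnitaryGroup.reindexGL_mem_iff σ e, hψg]; exact hh
  have key : ∀ γ : GL ι K, IsSiegelReindex e ((reindexGL e (blockDiagGL (γ, (1 : GL ι K))) : GL m K)⁻¹ * h) ↔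
      IsSiegelSum ((blockDiagGL (γ, (1 : GL ι K)))⁻¹ * g) := by
    intro γ
    rw [← hψg, ← map_inv, ← map_mul, isSiegelReindex_reindexGL_iff]
  simp only [key]
  exact existsUnique_isSiegelSum_blockDiagGL_inv_mul hS hg

/-- **the orbit lemma, re-enumerated mirror form**: every `h ∈ U(σ, reindex e e (S ⊕ −S))(K)` is `p · reindex(i(γ, 1))`
with `p ∈ P_Δ(K)` for a unique `γ ∈ U(σ, S)(K)`. [cite: GelbartPiatetskishapiroRallis1987, Part A §2 Lemma 2.1 p. 8] -/
theorem existsUnique_isSiegelReindex_mul_inv (hS : ∀ v : ι → K, hermForm σ S v v = 0 → v = 0) {h : GL m K}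
    (hh : h ∈ unitaryGroupOfForm σ (Matrix.reindex e e (diagForm S))) :
    ∃! γ : GL ι K, γ ∈ unitaryGroupOfForm σ S ∧
      IsSiegelReindex e (h * ((reindexGL e (blockDiagGL (γ, (1 : GL ι K))) : GL m K)⁻¹)) := by
  set ψ : GL (ι ⊕ ι) K ≃* GL m K := Units.mapEquiv (Matrix.reindexRingEquiv K e).toMulEquiv with hψ
  have hψe : ∀ g : GL (ι ⊕ ι) K, (reindexGL e g : GL m K) = ψ g := fun g => rfl
  set g := ψ.symm h with hgdef
  have hψg : (reindexGL e g : GL m K) = h := by rw [hψe]; exact ψ.apply_symm_apply h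
  have hg : g ∈ unitaryGroupOfForm σ (diagForm S) := by
    rw [← UnitaryGroup.reindexGL_mem_iff σ e, hψg]; exact hh
  have key : ∀ γ : GL ι K, IsSiegelReindex e (h * ((reindexGL e (blockDiagGL (γ, (1 : GL ι K))) : GL m K)⁻¹)) ↔
      IsSiegelSum (g * (blockDiagGL (γ, (1 : GL ι K)))⁻¹) := by
    intro γ
    rw [← hψg, ← map_inv, ← map_mul, isSiegelReindex_reindexGL_iff]
  simp only [key]
  exact existsUnique_isSiegelSum_mul_blockDiagGL_inv hS hg

/-- rank-one re-enumerated orbit lemma (e.g. `U(J ⊕ᶠ (−J))` for a hermitian line `J`, `e = finSumFinEquiv`): unique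
`γ ∈ U(σ, S)(K)` with `reindex(i(γ, 1))⁻¹ h ∈ P_Δ(K)`. [cite: GelbartPiatetskishapiroRallis1987, Part A §2 Lemma 2.1 p. 8; Li1992, §2 (24)–(25) p. 184] -/
theorem existsUnique_isSiegelReindex_inv_mul_of_rank_one [Unique ι] (hSu : IsUnit S.det) {h : GL m K}
    (hh : h ∈ unitaryGroupOfForm σ (Matrix.reindex e e (diagForm S))) :
    ∃! γ : GL ι K, γ ∈ unitaryGroupOfForm σ S ∧
      IsSiegelReindex e ((reindexGL e (blockDiagGL (γ, (1 : GL ι K))) : GL m K)⁻¹ * h) :=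
  existsUnique_isSiegelReindex_inv_mul e (anisotropic_of_isUnit_det σ hSu) hh

/-- rank-one re-enumerated orbit lemma, mirror form: unique `γ ∈ U(σ, S)(K)` with `h reindex(i(γ, 1))⁻¹ ∈ P_Δ(K)`.
[cite: GelbartPiatetskishapiroRallis1987, Part A §2 Lemma 2.1 p. 8; Li1992, §2 (24)–(25) p. 184] -/
theorem existsUnique_isSiegelReindex_mul_inv_of_rank_one [Unique ι] (hSu : IsUnit S.det) {h : GL m K}
    (hh : h ∈ unitaryGroupOfForm σ (Matrix.reindex e e (diagForm S))) :
    ∃! γ : GL ι K, γ ∈ unitaryGroupOfForm σ S ∧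
      IsSiegelReindex e (h * ((reindexGL e (blockDiagGL (γ, (1 : GL ι K))) : GL m K)⁻¹)) :=
  existsUnique_isSiegelReindex_mul_inv e (anisotropic_of_isUnit_det σ hSu) hh

end Reindex

/-! ## §7 The `J ⊕ᶠ (−J)` spelling of the see-saw carriers (`UnitaryGroup.finSum`, `UnitaryGroup.blockDiagFin`), subgroup-typed -/

section FinSpelling

variable {σ} {k : ℕ} {S : Matrix (Fin k) (Fin k) K}

/-- `J ⊕ᶠ (−J) = reindex e₂ e₂ (J ⊕ −J)` (`e₂ = finSumFinEquiv`): the `Fin`-spelling of the doubled Gram matrix is the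
re-enumerated `diagForm`. [cite: HarrisKudlaSweet1996, §1 (1.9)] -/
theorem finSum_neg_eq_reindex_diagForm (S : Matrix (Fin k) (Fin k) K) :
    UnitaryGroup.finSum k k S (-S) = Matrix.reindex finSumFinEquiv finSumFinEquiv (diagForm S) := rfl

/-- the doubling embedding in the `Fin`-spelling: `blockDiagFin σ S (−S) (γ₁, γ₂) = reindexGL e₂ (diag(γ₁, γ₂))` in `GL_{k+k}(K)`.
[cite: GelbartPiatetskishapiroRallis1987, Part A §2 p. 7] -/
theorem coe_blockDiagFin_neg (γ₁ : unitaryGroupOfForm σ S) (γ₂ : unitaryGroupOfForm σ (-S)) :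
    ((UnitaryGroup.blockDiagFin σ S (-S) (γ₁, γ₂) : unitaryGroupOfForm σ (UnitaryGroup.finSum k k S (-S))) :
        GL (Fin (k + k)) K) =
      reindexGL finSumFinEquiv (blockDiagGL ((γ₁ : GL (Fin k) K), (γ₂ : GL (Fin k) K))) := rfl

/-- **the orbit lemma in the `J ⊕ᶠ (−J)` spelling, subgroup-typed** (`𝕍` anisotropic): for `h ∈ U(σ, S ⊕ᶠ −S)(K)` there is a
UNIQUE `γ : U(σ, S)(K)` with `blockDiagFin (γ, 1)⁻¹ · h ∈ P_Δ(K)` (`IsSiegelReindex finSumFinEquiv`) — `γ ↦ i(γ, 1) P_Δ(K)` is a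
bijection `U(σ, S)(K) ≃ H(K) ∕ P_Δ(K)`. [cite: GelbartPiatetskishapiroRallis1987, Part A §2 Lemma 2.1 p. 8; HarrisKudlaSweet1996, §1 (1.2)–(1.3)] -/
theorem existsUnique_isSiegelReindex_blockDiagFin_inv_mul (hS : ∀ v : Fin k → K, hermForm σ S v v = 0 → v = 0)
    (h : unitaryGroupOfForm σ (UnitaryGroup.finSum k k S (-S))) :
    ∃! γ : unitaryGroupOfForm σ S, IsSiegelReindex finSumFinEquiv
      (((UnitaryGroup.blockDiagFin σ S (-S) (γ, 1) : unitaryGroupOfForm σ (UnitaryGroup.finSum k k S (-S))) :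
          GL (Fin (k + k)) K)⁻¹ * (h : GL (Fin (k + k)) K)) := by
  obtain ⟨γ, ⟨hγ, hγh⟩, huniq⟩ := existsUnique_isSiegelReindex_inv_mul finSumFinEquiv hS h.2
  refine ⟨⟨γ, hγ⟩, hγh, fun γ' hγ' => Subtype.ext (huniq _ ⟨γ'.2, hγ'⟩)⟩

/-- **the orbit lemma in the `J ⊕ᶠ (−J)` spelling, mirror form**: a UNIQUE `γ : U(σ, S)(K)` with
`h · blockDiagFin (γ, 1)⁻¹ ∈ P_Δ(K)` — `γ ↦ P_Δ(K) i(γ, 1)` is a bijection `U(σ, S)(K) ≃ P_Δ(K) \ H(K)`.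
[cite: GelbartPiatetskishapiroRallis1987, Part A §2 Lemma 2.1 p. 8; HarrisKudlaSweet1996, §1 (1.2)–(1.3)] -/
theorem existsUnique_isSiegelReindex_mul_blockDiagFin_inv (hS : ∀ v : Fin k → K, hermForm σ S v v = 0 → v = 0)
    (h : unitaryGroupOfForm σ (UnitaryGroup.finSum k k S (-S))) :
    ∃! γ : unitaryGroupOfForm σ S, IsSiegelReindex finSumFinEquiv
      ((h : GL (Fin (k + k)) K) *
        (((UnitaryGroup.blockDiagFin σ S (-S) (γ, 1) : unitaryGroupOfForm σ (UnitaryGroup.finSum k k S (-S))) :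
          GL (Fin (k + k)) K)⁻¹)) := by
  obtain ⟨γ, ⟨hγ, hγh⟩, huniq⟩ := existsUnique_isSiegelReindex_mul_inv finSumFinEquiv hS h.2
  refine ⟨⟨γ, hγ⟩, hγh, fun γ' hγ' => Subtype.ext (huniq _ ⟨γ'.2, hγ'⟩)⟩

/-- **rank one, `J ⊕ᶠ (−J)` spelling** (`k = 1`, `det S` a unit; `H = U(1,1)`-type doubled group of a hermitian line): a
UNIQUE `γ : U(σ, S)(K)` with `blockDiagFin (γ, 1)⁻¹ · h ∈ P_Δ(K)`. [cite: GelbartPiatetskishapiroRallis1987, Part A §2 Lemma 2.1 p. 8; Li1992, §2 (24)–(25) p. 184] -/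
theorem existsUnique_isSiegelReindex_blockDiagFin_inv_mul_of_rank_one {S : Matrix (Fin 1) (Fin 1) K} (hSu : IsUnit S.det)
    (h : unitaryGroupOfForm σ (UnitaryGroup.finSum 1 1 S (-S))) :
    ∃! γ : unitaryGroupOfForm σ S, IsSiegelReindex finSumFinEquiv
      (((UnitaryGroup.blockDiagFin σ S (-S) (γ, 1) : unitaryGroupOfForm σ (UnitaryGroup.finSum 1 1 S (-S))) :
          GL (Fin (1 + 1)) K)⁻¹ * (h : GL (Fin (1 + 1)) K)) :=
  existsUnique_isSiegelReindex_blockDiagFin_inv_mul (anisotropic_of_isUnit_det σ hSu) h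

/-- **rank one, `J ⊕ᶠ (−J)` spelling, mirror form**: a UNIQUE `γ : U(σ, S)(K)` with `h · blockDiagFin (γ, 1)⁻¹ ∈ P_Δ(K)`.
[cite: GelbartPiatetskishapiroRallis1987, Part A §2 Lemma 2.1 p. 8; Li1992, §2 (24)–(25) p. 184] -/
theorem existsUnique_isSiegelReindex_mul_blockDiagFin_inv_of_rank_one {S : Matrix (Fin 1) (Fin 1) K} (hSu : IsUnit S.det)
    (h : unitaryGroupOfForm σ (UnitaryGroup.finSum 1 1 S (-S))) :
    ∃! γ : unitaryGroupOfForm σ S, IsSiegelReindex finSumFinEquiv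
      ((h : GL (Fin (1 + 1)) K) *
        (((UnitaryGroup.blockDiagFin σ S (-S) (γ, 1) : unitaryGroupOfForm σ (UnitaryGroup.finSum 1 1 S (-S))) :
          GL (Fin (1 + 1)) K)⁻¹)) :=
  existsUnique_isSiegelReindex_mul_blockDiagFin_inv (anisotropic_of_isUnit_det σ hSu) h

end FinSpelling




end DoubledUnitary

end Literature.NumberTheory.Automorphic
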